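/-
Copyright (c) 2026 the pub-hodgecm-mathlib formalisation cell (harness21).  Prover seat hodgecm-mathlib-LH4-p17 (g0), req620 Track A «(D-RAM) FOUR-FRAME» squad, helper lane on
h413 = stmt-HodgeConjecture-24833 (count-neutral).  β-BOARD v1 (sub-dealer LH4-p05 (g8)) row R3 «G₁ ε-BOUNDARY TOWER FILE», FILE 5a: THE PER-ORBIT LABELLED ODD VALUE of the
glued representative `latt V(1,1,g)` beyond the one-slot cell — ★ p861456 HEAD A-χ instantiated with the glued label character of ★ p861560.  2026-09-04.
-/
import Summits.HodgeConjecture.HodgeConjecture.Theorems.F0P3cDyRamLabelledOddCharacterRead      -- ★ p861456 (this seat): `labelledOddCount_div_relIndex_eq_of_character`; brings ★ p13 `classSign_mul_eq_of_label`, ★ g36 `map_unitNormMap_unitStabilizer_le`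
import Summits.HodgeConjecture.HodgeConjecture.Theorems.F0P3cDyRamLabelledOddGluedCharacter     -- ★ p861560 (this seat): `gluedChar_mul`, `normSign_twoSlot_factor`, `ratios_…`; brings ★ κG-A2∕A1, ★ toolkit, ★ `…NonNormUnit`
import Summits.HodgeConjecture.HodgeConjecture.Theorems.F0P3cDyRamTwoSlotLabelReadGlued         -- ★ (LH4-p13 (g8)): `valueClassLabel_glued_rep_class_iff_normSign`
import Summits.HodgeConjecture.HodgeConjecture.Theorems.F0P3cDyRamValueClassLabelEquivariant     -- ★ (B2a-4⁰): `isTorusEquivariantLabel_valueClassLabel`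
import Summits.HodgeConjecture.HodgeConjecture.Theorems.F0P3cDyRamDiagonalOrbitFibreTransport    -- ★ (LH4-p10): `fibre_isCoset_zero`
import HarnessLib

/-!
# Crux `H413`, line LH4 «(D-RAM) FOUR-FRAME» — (β) Stage B, R3 FILE 5a «THE PER-ORBIT LABELLED ODD VALUE OF THE GLUED REPRESENTATIVE BEYOND THE CELL»
# `m^Λ_i(latt V(1,1,g)) ∕ [𝒰 : N(S̃′)] = ω(g_β(1+rg))·ω(D(g)_i)∕2 · [ω_i·λ_c ≡ 1 on S_F] · stabiliserWeight`,  `(ω(D(g)_i))_i = (ω(g), 1, ω(−1)ω(1+g))`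

Cell `hodgecm-mathlib` (D-0151), FLOOR 0, crux item H413 = `stmt-HodgeConjecture-24833`, route `HCCMUnconditional`; squad F0∕P3c∕LH4.  THEOREMS ONLY (no `def`, no instance, no
notation, no `sorry`, default heartbeats); ★-only imports; lane `--supports stmt-HodgeConjecture-24833 --as helper` (count-neutral); pays NO row, states NO law.

THE MATHEMATICS (β-BOARD v1 R3).  On the glued representative `V = latt V(1,1,g)` (`|g| = |ϖ|^{2t}`, `ρ, t ≥ 1`) with its explicit type-0 polarisation `D(g) = π₀^{−(ρ+t)}·(g, 1, −(1+g)⁻¹)`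
(★ κG-A1 `isVertexLattice_zero_latt_glued_rep`), normalised, `T`-stable, on the clean shell, with finite unit-torus orbit, the polarisations form `D(g)·S_F(V)` (★ `fibre_isCoset_zero`),
and the value-class label of the class `D(g)·u` reads `ω(u₀·g·g_α + u₁·g_β)` (★ p13 `valueClassLabel_glued_rep_class_iff_normSign`, approximants `g_α = r·g_β`, `g_β`).  By ★ p861560
`normSign_twoSlot_factor` this is `ε·λ_c(u)`, `ε = ω(g_β(1+rg))`, `λ_c(u) = ω(u₁)ω(1 + c(u₀∕u₁ − 1))`, `c = rg∕(1+rg)`, `|c| = |rg| = |ϖ|^{Δ}` — a `{±1}`-valued multiplicative character of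
`S_F(V)` (★ `gluedChar_mul`, conductor `2d ≤ Δ + 2ρ + 1`), trivial on `N(S̃′(V))` (★ p13 `classSign_mul_eq_of_label` at `u = 1`, the label being torus-equivariant ★).  So ★ p861456 HEAD A′-χ gives
* §2 HEAD `labelledOdd_div_relIndex_glued_rep_beyond_eq`: for every slot `i`,
  `m^Λ_i(V) ∕ [𝒰 : N(S̃′(V))] = ω(g_β(1+rg))·ω(D(g)_i)∕2 · [∀ u ∈ S_F(V), ω(u_i)·λ_c(u) = 1] · stabiliserWeight σ V`;
* §1 `normSign_gluedPolarisation`: `(ω(D(g)_i))_i = (ω(g), 1, ω(−1)·ω(1+g))` (`π₀^{−(ρ+t)} = N((ϖ^{ρ+t})⁻¹)`, `ω(x⁻¹) = ω(x)`).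
The three indicators are ★ p861560 §4 (slots 0, 1) and ★ FILE 3b (slot 2); the orbit sums are ★ FILE 4; the R3 HEAD assembles.
HONEST LABEL.  Count-neutral; proves no census ((β-BAL)∕(β)∕T₊ OPEN); `HC_CM` is proved only modulo the 7 printed citations (2 remaining named inputs: hLiu418 =
`stmt-HodgeConjecture-24832`, h413 = `stmt-HodgeConjecture-24833`) until rung 0 closes.
References: [Kottwitz1986BaseChangeUnits] §1 pp. 240–241 · [LanglandsShelstad1987] §3 · [Rogawski1990] §4.9 Prop. 4.9.1 (a)(b) p. 55, §4.10 p. 58 · [Serre1979] Ch. V §3 Cor. 3, Ch. XV §2.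
-/

set_option autoImplicit false

noncomputable section

namespace Summit.HodgeConjecture.HodgeConjecture.Cruxes.H413.F0P3cDyRamLabelledOddGluedRepBeyond

open Matrix WithZero
open Literature.NumberTheory.Automorphic Literature.NumberTheory.Automorphic.HermitianLattice Literature.NumberTheory.Automorphic.UnitaryGroup
open Literature.NumberTheory.Automorphic.UnitaryLatticeTree Literature.NumberTheory.Automorphic.UnitaryThreeFourFrame
open Literature.NumberTheory.LocalFields Literature.NumberTheory.LocalFields.WildQuadraticDatum
open Summit.HodgeConjecture.HodgeConjecture.Cruxes.H413.F0P3cDyRamFourFramePieces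
open Summit.HodgeConjecture.HodgeConjecture.Cruxes.H413.F0P3cDyRamFourFrameCensusDefs
open Summit.HodgeConjecture.HodgeConjecture.Cruxes.H413.F0P3cDyRamDiagonalTorusDefs
open Summit.HodgeConjecture.HodgeConjecture.Cruxes.H413.F0P3cDyRamLabelledOddCountDefs
open Summit.HodgeConjecture.HodgeConjecture.Cruxes.H413.F0P3cDyRamDiagonalKappaGluedClassForm (isVertexLattice_zero_latt_glued_rep)
open Summit.HodgeConjecture.HodgeConjecture.Cruxes.H413.F0P3cDyRamDiagonalOrbitFibreTransport (fibre_isCoset_zero)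
open Summit.HodgeConjecture.HodgeConjecture.Cruxes.H413.F0P3cDyRamFixedCountDiagonalModel (normSign_mul_norm)
open Summit.HodgeConjecture.HodgeConjecture.Cruxes.H413.F0P3cDyRamStableSumSignClasses (normSign_eq_one_or)
open Summit.HodgeConjecture.HodgeConjecture.Cruxes.H413.F0P3cDyRamLabelledOddOneSlotRead (map_unitNormMap_unitStabilizer_le normSign_one_eq)
open Summit.HodgeConjecture.HodgeConjecture.Cruxes.H413.F0P3cDyRamLabelledOddClassSignRead (classSign_mul_eq_of_label)
open Summit.HodgeConjecture.HodgeConjecture.Cruxes.H413.F0P3cDyRamLabelledOddCharacterRead (labelledOddCount_div_relIndex_eq_of_character)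
open Summit.HodgeConjecture.HodgeConjecture.Cruxes.H413.F0P3cDyRamLabelledOddGluedCharacter (ratios_of_mem_fixedUnitStabilizer_glued_rep gluedChar_mul normSign_twoSlot_factor)
open Summit.HodgeConjecture.HodgeConjecture.Cruxes.H413.F0P3cDyRamTwoSlotLabelReadGlued (valueClassLabel_glued_rep_class_iff_normSign)
open Summit.HodgeConjecture.HodgeConjecture.Cruxes.H413.F0P3cDyRamValueClassLabelEquivariant (isTorusEquivariantLabel_valueClassLabel)
open scoped Valued WithZero Matrix MatrixGroups

variable {K : Type} [Field K] [Valued K ℤᵐ⁰]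

/-! ## §1  The norm signs of the explicit polarisation `D(g)` -/

/-- **`(ω(D(g)_i))_i = (ω(g), 1, ω(−1)·ω(1+g))`** for `D(g) = π₀^{−(ρ+t)}·(g, 1, −(1+g)⁻¹)` (`g` fixed, `g, 1+g ≠ 0`; `π₀^{−(ρ+t)} = N((ϖ^{ρ+t})⁻¹)` is a norm, `ω(x⁻¹) = ω(x)`).
[cite: LanglandsShelstad1987, §3] [cite: Serre1979, Ch. V §3 Cor. 3] -/
theorem normSign_gluedPolarisation [CompleteSpace K] [Finite 𝓀[K]] {σ : K →+* K} {ϖ : K} {d t₂ : ℕ} (hD : IsRamifiedQuadraticDatum σ ϖ d t₂)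
    (ρ t : ℕ) {g : K} (hσg : σ g = g) (h1g0 : 1 + g ≠ 0) (i : Fin 3) :
    normSign σ ((![((ϖ * σ ϖ) ^ (ρ + t))⁻¹ * g, ((ϖ * σ ϖ) ^ (ρ + t))⁻¹, -(((ϖ * σ ϖ) ^ (ρ + t))⁻¹ * (1 + g)⁻¹)] : Fin 3 → K) i) =
      (![normSign σ g, 1, normSign σ (-1) * normSign σ (1 + g)] : Fin 3 → ℤ) i := by
  obtain ⟨hσ, -, hϖ, -, -, -, -⟩ := id hD
  have hϖ0 : ϖ ≠ 0 := (Valuation.ne_zero_iff Valued.v).1 (by rw [hϖ]; exact exp_ne_zero)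
  set D₁ : K := ((ϖ * σ ϖ) ^ (ρ + t))⁻¹ with hD₁
  have hD₁N : D₁ = (ϖ ^ (ρ + t))⁻¹ * σ ((ϖ ^ (ρ + t))⁻¹) := by rw [hD₁, map_inv₀, map_pow, mul_pow, mul_inv]
  have hz : ((ϖ ^ (ρ + t))⁻¹ : K) ≠ 0 := inv_ne_zero (pow_ne_zero _ hϖ0)
  have hσ1g : σ (1 + g) = 1 + g := by rw [map_add, map_one, hσg]
  have hω0 : normSign σ (D₁ * g) = normSign σ g := by rw [mul_comm, hD₁N, normSign_mul_norm σ g hz]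
  have hω1 : normSign σ D₁ = 1 := by rw [← one_mul D₁, hD₁N, normSign_mul_norm σ 1 hz, normSign_one_eq]
  have hω2 : normSign σ (-(D₁ * (1 + g)⁻¹)) = normSign σ (-1) * normSign σ (1 + g) := by
    rw [show -(D₁ * (1 + g)⁻¹) = (-1 * (1 + g)⁻¹) * D₁ by ring, hD₁N, normSign_mul_norm σ _ hz,
      normSign_mul_of_fixed hD (by rw [map_neg, map_one]) (by rw [map_inv₀, hσ1g]) (by norm_num) (inv_ne_zero h1g0), normSign_inv_of_map_eq σ hσ1g h1g0]
  fin_cases i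
  · exact hω0
  · exact hω1
  · exact hω2

/-! ## §2  HEAD — the per-orbit labelled odd value of the glued representative beyond the cell -/

open Classical in
/-- **HEAD — THE PER-ORBIT LABELLED ODD VALUE OF `latt V(1,1,g)` BEYOND THE ONE-SLOT CELL.**  Datum `hD`, `|2| < 1`, `ρ, t ≥ 1`, `g` fixed with `|g| = |ϖ|^{2t}`, `V(1,1,g)` normalised,
`T = diag(α,β,1)`-stable, with finite unit-torus orbit, on the clean shell of `X = diag(α−1, β−1, 0)` (levels `ℓ₀`, not `ℓ₀+1`, square at `mc`), element datum at `N₀ ≥ m*, ℓ₀+1` with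
`2ℓ₀+1, m*+ℓ₀ ≤ mc`; fixed `r, g_β` (`g_β ≠ 0`) with the read precisions `|ϖ^{−m*}·π₀^{−(ρ+t)}g·((α−1) − r g_β t₊)| ≤ 1`, `|ϖ^{−m*}·π₀^{−(ρ+t)}·((β−1) − g_β t₊)| ≤ 1`, and `|rg| = |ϖ|^Δ`,
`1 ≤ Δ`, `2d ≤ Δ + 2ρ + 1`.  Then for every slot `i`, with `c = rg∕(1+rg)` and `λ_c(u) = ω(u₁)·ω(1 + c(u₀∕u₁ − 1))`:
`m^Λ_i(latt V) ∕ [𝒰 : N(S̃′(latt V))] = ω(g_β(1+rg))·ω(D(g)_i)∕2 · [∀ u ∈ S_F(latt V), ω(u_i)·λ_c(u) = 1] · stabiliserWeight σ (latt V)`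
(★ p861456 HEAD A′-χ ∘ ★ p13 glued read ∘ ★ p861560 factor∕multiplicativity; `λ_c ≡ 1` on `N(S̃′)` by ★ `classSign_mul_eq_of_label`).
[cite: Kottwitz1986BaseChangeUnits, §1 pp. 240–241] [cite: LanglandsShelstad1987, §3] [cite: Rogawski1990, §4.9 Prop. 4.9.1 (a)(b) p. 55, §4.10 p. 58] -/
theorem labelledOdd_div_relIndex_glued_rep_beyond_eq [CompleteSpace K] [Finite 𝓀[K]] {σ : K →+* K} {ϖ : K} {d t₂ : ℕ} (hD : IsRamifiedQuadraticDatum σ ϖ d t₂)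
    {ρ t : ℕ} (hρ : 1 ≤ ρ) (ht : 1 ≤ t) {g : K} (hσg : σ g = g) (hg : Valued.v g = Valued.v ϖ ^ (2 * t))
    (V : GL (Fin 3) K) (hV : (V : Matrix (Fin 3) (Fin 3) K) = !![1, 0, 0; 1, ϖ ^ ρ, 0; 1 * 1 + g, ϖ ^ ρ * 1, ϖ ^ (2 * ρ + 2 * t)])
    (hn : IsNormalisedLattice (latt (V : Matrix (Fin 3) (Fin 3) K)))
    (hfin : {M : Submodule 𝒪[K] (Fin 3 → K) | ∃ u ∈ unitTorus K 3, M = mapGL (diagGLUnits u) (latt (V : Matrix (Fin 3) (Fin 3) K))}.Finite)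
    {α β : K} {N₀ n₁ n₂ n₃ : ℕ} (hE : IsElementDatum σ ϖ N₀ α β n₁ n₂ n₃) {mc : ℕ} (hℓN : d % 2 + 1 ≤ N₀) (hmN : d % 2 + 2 * d - 1 ≤ N₀)
    (hℓmc : 2 * (d % 2) + 1 ≤ mc) (hmmc : d % 2 + 2 * d - 1 + d % 2 ≤ mc)
    (hlev : LatticeInLevel ϖ (d % 2) (Matrix.diagonal ![α - 1, β - 1, 0]) (latt (V : Matrix (Fin 3) (Fin 3) K)))
    (hnlev : ¬ LatticeInLevel ϖ (d % 2 + 1) (Matrix.diagonal ![α - 1, β - 1, 0]) (latt (V : Matrix (Fin 3) (Fin 3) K)))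
    (hsq : LatticeInLevel ϖ mc (Matrix.diagonal ![(α - 1) * (α - 1), (β - 1) * (β - 1), 0]) (latt (V : Matrix (Fin 3) (Fin 3) K)))
    {T : GL (Fin 3) K} (hT : (T : Matrix (Fin 3) (Fin 3) K) = Matrix.diagonal ![α, β, 1]) (hTM : mapGL T (latt (V : Matrix (Fin 3) (Fin 3) K)) = latt (V : Matrix (Fin 3) (Fin 3) K))
    {r gβ : K} (hσr : σ r = r) (hσgβ : σ gβ = gβ) (hgβ0 : gβ ≠ 0)
    (hgα : Valued.v ((ϖ ^ (d % 2 + 2 * d - 1))⁻¹ * (((ϖ * σ ϖ) ^ (ρ + t))⁻¹ * g * ((α - 1) - r * gβ * ((ϖ - σ ϖ) * ((ϖ * σ ϖ) ^ ((d - d % 2) / 2))⁻¹)))) ≤ 1)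
    (hgβ : Valued.v ((ϖ ^ (d % 2 + 2 * d - 1))⁻¹ * (((ϖ * σ ϖ) ^ (ρ + t))⁻¹ * ((β - 1) - gβ * ((ϖ - σ ϖ) * ((ϖ * σ ϖ) ^ ((d - d % 2) / 2))⁻¹)))) ≤ 1)
    {Δ : ℕ} (hΔ1 : 1 ≤ Δ) (hrg : Valued.v (r * g) = Valued.v ϖ ^ Δ) (hΔ : 2 * d ≤ Δ + 2 * ρ + 1) (i : Fin 3) :
    (labelledOddCount σ ϖ 0 i (valueClassLabel σ ϖ (α - 1) (β - 1) (d % 2 + 2 * d - 1) d) (latt (V : Matrix (Fin 3) (Fin 3) K)) : ℚ) /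
        ((((unitStabilizer (latt (V : Matrix (Fin 3) (Fin 3) K))).map (unitNormMap σ 3)).relIndex (fixedUnitTorus σ 3) : ℕ) : ℚ) =
      (normSign σ (gβ * (1 + r * g)) : ℚ) * ((![normSign σ g, 1, normSign σ (-1) * normSign σ (1 + g)] : Fin 3 → ℤ) i : ℚ) / 2 *
        ((if ∀ u ∈ fixedUnitStabilizer σ (latt (V : Matrix (Fin 3) (Fin 3) K)),
              normSign σ ((u i : Kˣ) : K) * (normSign σ ((u 1 : Kˣ) : K) * normSign σ (1 + r * g / (1 + r * g) * (((u 0 : Kˣ) : K) / ((u 1 : Kˣ) : K) - 1))) = 1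
            then 1 else 0 : ℤ) : ℚ) *
        stabiliserWeight σ (latt (V : Matrix (Fin 3) (Fin 3) K)) := by
  classical
  obtain ⟨hσ, hvσ, hϖ, hfix, hdd, hd1, -⟩ := id hD
  haveI : IsAdicComplete 𝓂[K] 𝒪[K] := isAdicComplete_valuedInteger_of_completeSpace hϖ
  have hϖ0 : ϖ ≠ 0 := (Valuation.ne_zero_iff Valued.v).1 (by rw [hϖ]; exact exp_ne_zero)
  have hvϖ : 0 < Valued.v ϖ := (Valuation.pos_iff _).2 hϖ0
  have hϖ1 : Valued.v ϖ < 1 := by rw [hϖ, ← exp_zero, exp_lt_exp]; norm_num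
  have hϖle : ∀ n : ℕ, Valued.v ϖ ^ n ≤ 1 := fun n => pow_le_one₀ zero_le hϖ1.le
  have hσϖ0 : σ ϖ ≠ 0 := (map_ne_zero σ).2 hϖ0
  -- the non-norm witness and the dichotomy
  obtain ⟨c₀, hσc₀, hc₀v, hc₀n, hdich⟩ := exists_nonnorm_dichotomy_of_isRamifiedQuadraticDatum σ ϖ d t₂ hD
  -- `g`, `1 + g`, `rg`, `1 + rg`
  have hg0 : g ≠ 0 := fun h => by rw [h, map_zero] at hg; exact (pow_ne_zero _ hvϖ.ne') hg.symm
  have hglt : Valued.v g < 1 := by rw [hg]; exact pow_lt_one₀ zero_le hϖ1 (by omega)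
  have h1g : Valued.v (1 + g) = 1 := Valued.v.map_one_add_of_lt hglt
  have h1g0 : (1 : K) + g ≠ 0 := fun h => by rw [h, map_zero] at h1g; exact zero_ne_one h1g
  have hrglt : Valued.v (r * g) < 1 := by rw [hrg]; exact pow_lt_one₀ zero_le hϖ1 (by omega)
  have h1rg : Valued.v (1 + r * g) = 1 := Valued.v.map_one_add_of_lt hrglt
  have h1rg0 : (1 : K) + r * g ≠ 0 := fun h => by rw [h, map_zero] at h1rg; exact zero_ne_one h1rg
  have hσ1rg : σ (1 + r * g) = 1 + r * g := by rw [map_add, map_one, map_mul, hσr, hσg]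
  -- the base polarisation `D(g)`
  set π : K := (ϖ * σ ϖ) ^ (ρ + t) with hπdef
  have hπ0 : π ≠ 0 := pow_ne_zero _ (mul_ne_zero hϖ0 hσϖ0)
  have hσπ : σ π = π := by rw [hπdef, map_pow, map_mul, hσ, mul_comm]
  have hσ1g : σ (1 + g) = 1 + g := by rw [map_add, map_one, hσg]
  set D₁ : Fin 3 → K := ![π⁻¹ * g, π⁻¹, -(π⁻¹ * (1 + g)⁻¹)] with hD₁def
  have hD₁ : ∀ j, σ (D₁ j) = D₁ j ∧ D₁ j ≠ 0 := by
    intro j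
    fin_cases j
    · exact ⟨by show σ (π⁻¹ * g) = π⁻¹ * g; rw [map_mul, map_inv₀, hσπ, hσg], mul_ne_zero (inv_ne_zero hπ0) hg0⟩
    · exact ⟨by show σ π⁻¹ = π⁻¹; rw [map_inv₀, hσπ], inv_ne_zero hπ0⟩
    · exact ⟨by show σ (-(π⁻¹ * (1 + g)⁻¹)) = -(π⁻¹ * (1 + g)⁻¹); rw [map_neg, map_mul, map_inv₀, map_inv₀, hσπ, hσ1g],
        neg_ne_zero.2 (mul_ne_zero (inv_ne_zero hπ0) (inv_ne_zero h1g0))⟩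
  have hV₁ : IsVertexLattice σ ϖ (Matrix.diagonal D₁) 0 (latt (V : Matrix (Fin 3) (Fin 3) K)) :=
    isVertexLattice_zero_latt_glued_rep hσ hvσ hϖ0 hϖ1 ρ t hσg hg ht V hV
  have hcoset : ∀ D : Fin 3 → K, (∀ j, σ (D j) = D j ∧ D j ≠ 0) →
      (IsVertexLattice σ ϖ (Matrix.diagonal D) 0 (latt (V : Matrix (Fin 3) (Fin 3) K)) ↔
        ∃ u ∈ fixedUnitStabilizer σ (latt (V : Matrix (Fin 3) (Fin 3) K)), ∀ j, D j = D₁ j * ((u j : Kˣ) : K)) :=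
    fun D hD' => fibre_isCoset_zero hvσ ϖ V rfl hn D₁ hD₁ hV₁ D hD'
  have hNS := map_unitNormMap_unitStabilizer_le σ hσ ϖ 0 hD₁ hV₁ hcoset
  -- the label character and its sign
  set cc : K := r * g / (1 + r * g) with hccdef
  have hσcc : σ cc = cc := by rw [hccdef, map_div₀, map_mul, hσr, hσg, hσ1rg]
  have hvcc : Valued.v cc ≤ Valued.v ϖ ^ Δ := by rw [hccdef, map_div₀, h1rg, div_one, hrg]
  set lam : (Fin 3 → Kˣ) → ℤ := fun u => normSign σ ((u 1 : Kˣ) : K) * normSign σ (1 + cc * (((u 0 : Kˣ) : K) / ((u 1 : Kˣ) : K) - 1)) with hlamdef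
  set ε : ℤ := normSign σ (gβ * (1 + r * g)) with hεdef
  have hε : ε = 1 ∨ ε = -1 := normSign_eq_one_or σ _
  have hval : ∀ u ∈ fixedUnitStabilizer σ (latt (V : Matrix (Fin 3) (Fin 3) K)), lam u = 1 ∨ lam u = -1 := fun u _ => by
    rcases normSign_eq_one_or σ ((u 1 : Kˣ) : K) with h1 | h1 <;>
      rcases normSign_eq_one_or σ (1 + cc * (((u 0 : Kˣ) : K) / ((u 1 : Kˣ) : K) - 1)) with h2 | h2 <;> simp [hlamdef, h1, h2]
  have hmul : ∀ u ∈ fixedUnitStabilizer σ (latt (V : Matrix (Fin 3) (Fin 3) K)), ∀ u' ∈ fixedUnitStabilizer σ (latt (V : Matrix (Fin 3) (Fin 3) K)),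
      lam (u * u') = lam u * lam u' := fun u hu u' hu' => gluedChar_mul hD hρ ht hg V hV hσcc hvcc hΔ hu hu'
  -- the label read on the classes: `Λ(V, D(g)·u) ↔ ε·λ(u) = 1`
  have hΛ : ∀ u ∈ fixedUnitStabilizer σ (latt (V : Matrix (Fin 3) (Fin 3) K)),
      valueClassLabel σ ϖ (α - 1) (β - 1) (d % 2 + 2 * d - 1) d (latt (V : Matrix (Fin 3) (Fin 3) K)) (fun j => D₁ j * ((u j : Kˣ) : K)) ↔ ε * lam u = 1 := by
    intro u hu
    obtain ⟨-, hu1, hu2⟩ := (mem_fixedUnitStabilizer_iff σ _ u).1 hu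
    have huT : u ∈ fixedUnitTorus σ 3 := (mem_fixedUnitTorus_iff σ u).2 ⟨hu1, hu2⟩
    have hu0 : ∀ j, ((u j : Kˣ) : K) ≠ 0 := fun j => (u j).ne_zero
    have hDu : ∀ j, σ (D₁ j * ((u j : Kˣ) : K)) = D₁ j * ((u j : Kˣ) : K) ∧ D₁ j * ((u j : Kˣ) : K) ≠ 0 := fun j =>
      ⟨by rw [map_mul, (hD₁ j).1, hu2], mul_ne_zero (hD₁ j).2 (hu0 j)⟩
    have hM : IsVertexLattice σ ϖ (Matrix.diagonal fun j => D₁ j * ((u j : Kˣ) : K)) 0 (latt (V : Matrix (Fin 3) (Fin 3) K)) :=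
      (hcoset _ hDu).2 ⟨u, hu, fun _ => rfl⟩
    -- the precision hypotheses of ★ p13's read, with `u₀`, `u₁` inserted
    have hgα' : Valued.v ((ϖ ^ (d % 2 + 2 * d - 1))⁻¹ * (π⁻¹ * g * ((u 0 : Kˣ) : K) * ((α - 1) - (r * gβ) * ((ϖ - σ ϖ) * ((ϖ * σ ϖ) ^ ((d - d % 2) / 2))⁻¹)))) ≤ 1 := by
      rw [show (ϖ ^ (d % 2 + 2 * d - 1))⁻¹ * (π⁻¹ * g * ((u 0 : Kˣ) : K) * ((α - 1) - (r * gβ) * ((ϖ - σ ϖ) * ((ϖ * σ ϖ) ^ ((d - d % 2) / 2))⁻¹))) =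
          ((u 0 : Kˣ) : K) * ((ϖ ^ (d % 2 + 2 * d - 1))⁻¹ * (π⁻¹ * g * ((α - 1) - r * gβ * ((ϖ - σ ϖ) * ((ϖ * σ ϖ) ^ ((d - d % 2) / 2))⁻¹)))) by ring,
        map_mul, hu1 0, one_mul]
      exact hgα
    have hgβ' : Valued.v ((ϖ ^ (d % 2 + 2 * d - 1))⁻¹ * (π⁻¹ * ((u 1 : Kˣ) : K) * ((β - 1) - gβ * ((ϖ - σ ϖ) * ((ϖ * σ ϖ) ^ ((d - d % 2) / 2))⁻¹)))) ≤ 1 := by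
      rw [show (ϖ ^ (d % 2 + 2 * d - 1))⁻¹ * (π⁻¹ * ((u 1 : Kˣ) : K) * ((β - 1) - gβ * ((ϖ - σ ϖ) * ((ϖ * σ ϖ) ^ ((d - d % 2) / 2))⁻¹))) =
          ((u 1 : Kˣ) : K) * ((ϖ ^ (d % 2 + 2 * d - 1))⁻¹ * (π⁻¹ * ((β - 1) - gβ * ((ϖ - σ ϖ) * ((ϖ * σ ϖ) ^ ((d - d % 2) / 2))⁻¹)))) by ring,
        map_mul, hu1 1, one_mul]
      exact hgβ
    have hread := valueClassLabel_glued_rep_class_iff_normSign hD hρ hglt hg0 V hV hσg (u := fun j => ((u j : Kˣ) : K)) hu2 hu0 hn hM hE hℓN hmN hℓmc hmmc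
      hlev hnlev hsq hT hTM (gα := r * gβ) (gβ := gβ) (by rw [map_mul, hσr, hσgβ]) hσgβ hgα' hgβ'
    rw [hread]
    -- factor the two-slot read as SIGN × CHARACTER
    have hv : Valued.v (r * g / (1 + r * g) * (((u 0 : Kˣ) : K) / ((u 1 : Kˣ) : K) - 1)) < 1 := by
      have h1 := (ratios_of_mem_fixedUnitStabilizer_glued_rep (σ := σ) hϖ0 hϖ1 ht hg V hV hu).1
      rw [map_mul]
      calc Valued.v (r * g / (1 + r * g)) * Valued.v (((u 0 : Kˣ) : K) / ((u 1 : Kˣ) : K) - 1) ≤ Valued.v ϖ ^ Δ * Valued.v ϖ ^ ρ := mul_le_mul' hvcc h1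
        _ < 1 := by rw [← pow_add]; exact pow_lt_one₀ zero_le hϖ1 (by omega)
    rw [normSign_twoSlot_factor hD hσg hσr hσgβ hgβ0 hrglt huT hv]
  -- `λ ≡ 1` on `N(S̃′)`: the class sign `ε·λ` is `N′`-invariant (torus-equivariant label), read at `u = 1`
  have hlam1 : lam 1 = 1 := by
    simp only [hlamdef, Pi.one_apply, Units.val_one, div_one, sub_self, mul_zero, add_zero, normSign_one_eq, mul_one]
  have hN : ∀ n ∈ (unitStabilizer (latt (V : Matrix (Fin 3) (Fin 3) K))).map (unitNormMap σ 3), lam n = 1 := by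
    intro n hn'
    have hεval : ∀ u ∈ fixedUnitStabilizer σ (latt (V : Matrix (Fin 3) (Fin 3) K)), ε * lam u = 1 ∨ ε * lam u = -1 := fun u hu => by
      rcases hε with h | h <;> rcases hval u hu with h' | h' <;> rw [h, h'] <;> norm_num
    have h := classSign_mul_eq_of_label (M₀ := latt (V : Matrix (Fin 3) (Fin 3) K)) (D₁ := D₁)
      (isTorusEquivariantLabel_valueClassLabel σ ϖ (α - 1) (β - 1) (d % 2 + 2 * d - 1) d) hNS (lam := fun u => ε * lam u) hεval hΛ (one_mem _) hn'
    simp only [one_mul, hlam1, mul_one] at h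
    rcases hε with h1 | h1 <;> rw [h1] at h <;> linarith
  -- ★ p861456 HEAD A′-χ
  rw [labelledOddCount_div_relIndex_eq_of_character hσ hvσ hσc₀ hc₀v hc₀n hdich hfin hD₁ hV₁ hcoset _ i hε hmul hval hN hΛ,
    normSign_gluedPolarisation hD ρ t hσg h1g0 i]

end Summit.HodgeConjecture.HodgeConjecture.Cruxes.H413.F0P3cDyRamLabelledOddGluedRepBeyond

end
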